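import Summits.CriticalPhenomena.SAWScalingLimit.Theses.SAWBrickWallHomotopy
import Summits.CriticalPhenomena.SAWScalingLimit.Theorems.SAWBrickWallHomotopyModulusUniversalityJitteredDrawing
import Summits.CriticalPhenomena.SAWScalingLimit.Theorems.SAWBrickWallHomotopyModulusUniversalityLipOfEndpointCoupling
import Summits.CriticalPhenomena.SAWScalingLimit.Theorems.SAWBrickWallHomotopyModulusUniversalityConcatenation
import Literature.Probability.RandomPlanarGeometry.SAWBrickWallHex
import Literature.Probability.Percolation.LoopRotationInvarianceCoupling
import HarnessLib

/-!
# `ModulusUniversality`, line `birth`: stub L follows from the middle coupling (stub L, layer 4)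

Helper file (`--supports stmt-CriticalPhenomena-5790`) of the line `birth` / `registered` for the
crux `SAWBrickWallHomotopy.ModulusUniversality` (skeleton
`Summits/CriticalPhenomena/SAWScalingLimit/Cruxes/ModulusUniversality/Lines/birth.lean`): the
registered helper sub-goal `stub_jitteredLipMerging_of_middleCoupling` of the open stub L
(`stub_jitteredLipMerging`), proved — the reduction of L to ONE purely lattice/coupling statement,
the MIDDLE COUPLING, with no curve topology left in the hypothesis.

Stub L compares, for the affinity `B(x + iy) = 2x + i(2/√3)y`, the straight brick-wall law
`SAW.brickWallLaw E δ 0 (a δ) (b δ)` (`ℤ²` conventions, `t = 0`; drawn through the mesh points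
`δ x`) with the jittered law `SAW.embLaw hexGraph (B ∘ hexCenter) E δ x_c (a' δ) (b' δ)`
(honeycomb conventions; drawn through `δ B(c_w)`, i.e. the brick-wall site
`(2w₀ + w₁ + k + 1, w₁)` displaced vertically by `δ(k+1)/3`) on bounded Lipschitz test functions
of the curve class.  MIDDLE COUPLING (the hypothesis, written out in full in the registered
signature): for every `ρ > 0` and all small `δ` there is a coupling `Q` of the two laws under
which, off an event of `Q`-mass `≤ ρ`, the straight support and the brick-wall sites under the
jittered support decompose as `α₁ ++ m ++ β₁`, `α₂ ++ m ++ β₂` with a COMMON middle block `m`,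
all prefix sites drawn in the `ρ`-ball at `E.pt 0` and all suffix sites in the `ρ`-ball at
`E.pt 1` (content: disputed-collar non-hitting away from the endpoints + insensitivity to the
microscopic endpoint data of the critical honeycomb two-point walk; OPEN, not asserted here).

Proof of `middle coupling → L`, all soft:
* `dist_curve_le_of_support_eq` — on the good event the two curve classes are
  `≤ 2ρ + 2|δ|/3` apart: the concatenation lemma (`dist_mk_polyline_commonMiddle_le`, file
  `…Concatenation.lean`) for the two STRAIGHT drawings, whose first/last vertices are the drawn
  endpoints, plus the drawing coupling `dist_toCurve_straight_jittered_le` (file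
  `…JitteredDrawing.lean`) between the straight and the jittered drawing of the second walk;
* `tendsto_levyProkhorovDist_of_middleCoupling` — the endpoint closeness is eventual by the two
  endpoint approximations and the `2δ/3` jitter bound (`dist_meshPoint_site_le`), so for
  `δ < ρ` the curves are `≤ 3ρ` apart off the bad event, and the coupling pushed to
  `CurveClass ℂ × CurveClass ℂ` bounds the Lévy–Prokhorov edistance of the two curve laws by `3ρ`
  (the tree's `Literature.Probability.Percolation.levyProkhorovEDist_le_of_coupling`); `ρ` being
  arbitrary, the Lévy–Prokhorov distance tends to `0` — the two-convention endpoint coupling;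
* the landed `stub_jitteredLipMerging_of_endpointCoupling` (file `…LipOfEndpointCoupling.lean`)
  turns that into the text of stub L.

All bookkeeping tagged [folklore].
-/

noncomputable section

open MeasureTheory Filter Topology
open scoped NNReal ENNReal
open Literature.Probability.LatticeModels
open Literature.Probability.RandomPlanarGeometry

namespace Summit.CriticalPhenomena.SAWScalingLimit.Cruxes.ModulusUniversality.Birth

/-! ### On the good event of the middle coupling the two curves are close -/

/-- The mapped support of a walk starts at the image of its initial vertex. [folklore] -/
theorem head?_support_map {V W : Type*} {G : SimpleGraph V} {u v : V} (p : G.Walk u v)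
    (f : V → W) : (p.support.map f).head? = some (f u) := by
  rw [List.head?_map, List.head?_eq_some_head p.support_ne_nil, SimpleGraph.Walk.head_support]
  rfl

/-- The mapped support of a walk ends at the image of its final vertex. [folklore] -/
theorem getLast?_support_map {V W : Type*} {G : SimpleGraph V} {u v : V} (p : G.Walk u v)
    (f : V → W) : (p.support.map f).getLast? = some (f v) := by
  rw [List.getLast?_map, List.getLast?_eq_some_getLast p.support_ne_nil,
    SimpleGraph.Walk.getLast_support]
  rfl

/-- **Deterministic core of the reduction.** If the support of a straight SAW `γ₁` (drawn through
the mesh points `δ x`) and the brick-wall sites under the support of a jittered SAW `γ₂` (drawn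
through `δ B(c_w)`, `B = diag(2, 2/√3)`) decompose as `α₁ ++ m ++ β₁`, `α₂ ++ m ++ β₂` with a
COMMON middle block `m`, the prefix sites drawn in the closed `ρ`-ball at `p`, the suffix sites
in the closed `ρ`-ball at `q`, and the four endpoints drawn `ρ`-close to `p` resp. `q`, then the
two curve classes are `≤ 2ρ + 2|δ|/3` apart: the concatenation lemma for the two STRAIGHT
drawings (`dist_mk_polyline_commonMiddle_le`; their first/last vertices are the drawn endpoints,
`head?_support_map`, `getLast?_support_map`) plus the drawing coupling
(`dist_toCurve_straight_jittered_le`). [folklore] -/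
theorem dist_curve_le_of_support_eq {B : ℂ ≃ₜ ℂ}
    (hB : ∀ z : ℂ, B z = ((2 * z.re : ℝ) : ℂ) + ((2 / Real.sqrt 3 * z.im : ℝ) : ℂ) * Complex.I)
    {Ω : Set ℂ} {δ ρ : ℝ} (hρ : 0 ≤ ρ) (p q : ℂ) {a b : Site 2} {a' b' : HexVertex}
    (γ₁ : SAW.DomainSAW Ω δ a b)
    (γ₂ : SAW.EmbDomainSAW hexGraph (fun v : HexVertex => B (hexCenter v)) Ω δ a' b')
    {α₁ β₁ α₂ β₂ m : List (Site 2)} (h₁ : γ₁.walk.support = α₁ ++ m ++ β₁)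
    (h₂ : γ₂.walk.support.map (fun w : HexVertex =>
      (![2 * w.1 0 + w.1 1 + ((w.2 : ℕ) : ℤ) + 1, w.1 1] : Site 2)) = α₂ ++ m ++ β₂)
    (hα : ∀ x ∈ α₁ ++ α₂, dist (meshPoint δ x) p ≤ ρ)
    (hβ : ∀ x ∈ β₁ ++ β₂, dist (meshPoint δ x) q ≤ ρ)
    (ha : dist (meshPoint δ a) p ≤ ρ) (hb : dist (meshPoint δ b) q ≤ ρ)
    (ha' : dist (meshPoint δ (![2 * a'.1 0 + a'.1 1 + ((a'.2 : ℕ) : ℤ) + 1, a'.1 1] : Site 2)) p ≤ ρ)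
    (hb' : dist (meshPoint δ (![2 * b'.1 0 + b'.1 1 + ((b'.2 : ℕ) : ℤ) + 1, b'.1 1] : Site 2)) q ≤ ρ) :
    dist γ₁.curve γ₂.curve ≤ 2 * ρ + 2 * |δ| / 3 := by
  set f : Site 2 → ℂ := meshPoint δ with hf
  -- the straight drawing of `γ₂`
  set c₂ : CurveClass ℂ := CurveClass.mk ⟨polyline (α₂.map f ++ m.map f ++ β₂.map f)⟩ with hc₂
  have hγ₁ : γ₁.curve = CurveClass.mk ⟨polyline (α₁.map f ++ m.map f ++ β₁.map f)⟩ := by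
    show CurveClass.mk ⟨polyline (γ₁.walk.support.map (meshPoint δ))⟩ = _
    rw [h₁, List.map_append, List.map_append]
  have hγ₂ : dist c₂ γ₂.curve ≤ 2 * |δ| / 3 := by
    have h := dist_toCurve_straight_jittered_le hB δ γ₂.walk
    rw [h₂, List.map_append, List.map_append] at h
    exact h
  -- the first and last vertices of the two straight drawings are the drawn endpoints
  have hx₁ : (α₁.map f ++ m.map f ++ β₁.map f).head? = some (f a) := by
    rw [← List.map_append, ← List.map_append, ← h₁]
    exact head?_support_map γ₁.walk f
  have hy₁ : (α₁.map f ++ m.map f ++ β₁.map f).getLast? = some (f b) := by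
    rw [← List.map_append, ← List.map_append, ← h₁]
    exact getLast?_support_map γ₁.walk f
  have hx₂ : (α₂.map f ++ m.map f ++ β₂.map f).head? =
      some (f (![2 * a'.1 0 + a'.1 1 + ((a'.2 : ℕ) : ℤ) + 1, a'.1 1] : Site 2)) := by
    rw [← List.map_append, ← List.map_append, ← h₂, List.map_map]
    exact head?_support_map γ₂.walk _
  have hy₂ : (α₂.map f ++ m.map f ++ β₂.map f).getLast? =
      some (f (![2 * b'.1 0 + b'.1 1 + ((b'.2 : ℕ) : ℤ) + 1, b'.1 1] : Site 2)) := by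
    rw [← List.map_append, ← List.map_append, ← h₂, List.map_map]
    exact getLast?_support_map γ₂.walk _
  have hα' : ∀ z ∈ α₁.map f ++ α₂.map f, dist z p ≤ ρ := fun z hz => by
    rw [← List.map_append, List.mem_map] at hz
    obtain ⟨x, hx, rfl⟩ := hz
    exact hα x hx
  have hβ' : ∀ z ∈ β₁.map f ++ β₂.map f, dist z q ≤ ρ := fun z hz => by
    rw [← List.map_append, List.mem_map] at hz
    obtain ⟨x, hx, rfl⟩ := hz
    exact hβ x hx
  have hcat := dist_mk_polyline_commonMiddle_le p q ρ hρ (α₁.map f) (β₁.map f) (α₂.map f)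
    (β₂.map f) (m.map f) _ _ _ _ hx₁ hy₁ hx₂ hy₂ ha hb ha' hb' hα' hβ'
  calc dist γ₁.curve γ₂.curve ≤ dist γ₁.curve c₂ + dist c₂ γ₂.curve := dist_triangle _ _ _
    _ ≤ 2 * ρ + 2 * |δ| / 3 := by
        rw [hγ₁]
        exact add_le_add hcat hγ₂

/-! ### Middle coupling ⇒ two-convention endpoint coupling (Lévy–Prokhorov form) -/

open Literature.Probability.Percolation (levyProkhorovEDist_le_of_coupling) in
/-- **Middle coupling implies the two-convention endpoint coupling**, pointwise in the data
`(E; a, b; a', b')`: given, for every `ρ > 0` and all small `δ`, a coupling of the straight and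
the jittered laws under which, off an event of mass `≤ ρ`, the two supports (the jittered one
read on brick-wall sites) share a common middle block with prefixes drawn in `B(E.pt 0, ρ)` and
suffixes in `B(E.pt 1, ρ)`, the Lévy–Prokhorov distance of the two curve laws tends to `0`.
On the good event the curves are `≤ 2ρ + 2δ/3 ≤ 3ρ` apart (`dist_curve_le_of_support_eq`; the
endpoint closeness is eventual by the two endpoint approximations and the `2δ/3` jitter bound
`dist_meshPoint_site_le`), so the coupling pushed to `CurveClass ℂ × CurveClass ℂ` bounds the
Lévy–Prokhorov edistance by `3ρ` (`levyProkhorovEDist_le_of_coupling`). [folklore] -/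
theorem tendsto_levyProkhorovDist_of_middleCoupling {B : ℂ ≃ₜ ℂ}
    (hB : ∀ z : ℂ, B z = ((2 * z.re : ℝ) : ℂ) + ((2 / Real.sqrt 3 * z.im : ℝ) : ℂ) * Complex.I)
    (E : DobrushinDomain) (a b : ℝ → Site 2) (a' b' : ℝ → HexVertex)
    (hab : SAW.IsEndpointApprox E a b)
    (hab' : SAW.IsEmbEndpointApprox hexGraph (fun v : HexVertex => B (hexCenter v)) E a' b')
    (hM : ∀ ρ : ℝ, 0 < ρ → ∀ᶠ δ in nhdsWithin 0 (Set.Ioi 0),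
      ∃ Q : Measure (SAW.DomainSAW E.carrier δ (a δ) (b δ) ×
          SAW.EmbDomainSAW hexGraph (fun v : HexVertex => B (hexCenter v)) E.carrier δ
            (a' δ) (b' δ)),
        Q.map Prod.fst = SAW.brickWallLaw E.carrier δ 0 (a δ) (b δ) ∧
        Q.map Prod.snd = SAW.embLaw hexGraph (fun v : HexVertex => B (hexCenter v)) E.carrier δ
          SAW.hexCriticalFugacity (a' δ) (b' δ) ∧
        Q {p | ¬ ∃ (α₁ β₁ α₂ β₂ m : List (Site 2)),
            p.1.walk.support = α₁ ++ m ++ β₁ ∧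
            p.2.walk.support.map (fun w : HexVertex =>
              (![2 * w.1 0 + w.1 1 + ((w.2 : ℕ) : ℤ) + 1, w.1 1] : Site 2)) = α₂ ++ m ++ β₂ ∧
            (∀ x ∈ α₁ ++ α₂, dist (meshPoint δ x) (E.pt 0) < ρ) ∧
            (∀ x ∈ β₁ ++ β₂, dist (meshPoint δ x) (E.pt 1) < ρ)} ≤ ENNReal.ofReal ρ) :
    Tendsto (fun δ => levyProkhorovDist
        ((SAW.brickWallLaw E.carrier δ 0 (a δ) (b δ)).map (fun γ => γ.curve))
        ((SAW.embLaw hexGraph (fun v : HexVertex => B (hexCenter v)) E.carrier δ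
          SAW.hexCriticalFugacity (a' δ) (b' δ)).map (fun γ => γ.curve)))
      (nhdsWithin 0 (Set.Ioi 0)) (nhds 0) := by
  rw [Metric.tendsto_nhds]
  intro ε hε
  -- work at scale `ρ = ε / 4`
  set ρ : ℝ := ε / 4 with hρdef
  have hρ : 0 < ρ := by positivity
  have hρ3 : 0 < ρ / 3 := by positivity
  -- eventual facts: the coupling, endpoint closeness, small mesh
  have e1 := hM ρ hρ
  have e2 : ∀ᶠ δ in nhdsWithin 0 (Set.Ioi 0), dist (meshPoint δ (a δ)) (E.pt 0) < ρ :=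
    Metric.tendsto_nhds.1 hab.tendsto_fst ρ hρ
  have e3 : ∀ᶠ δ in nhdsWithin 0 (Set.Ioi 0), dist (meshPoint δ (b δ)) (E.pt 1) < ρ :=
    Metric.tendsto_nhds.1 hab.tendsto_snd ρ hρ
  have e4 : ∀ᶠ δ : ℝ in nhdsWithin 0 (Set.Ioi 0),
      dist ((δ : ℂ) * B (hexCenter (a' δ))) (E.pt 0) < ρ / 3 :=
    Metric.tendsto_nhds.1 hab'.tendsto_fst (ρ / 3) hρ3
  have e5 : ∀ᶠ δ : ℝ in nhdsWithin 0 (Set.Ioi 0),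
      dist ((δ : ℂ) * B (hexCenter (b' δ))) (E.pt 1) < ρ / 3 :=
    Metric.tendsto_nhds.1 hab'.tendsto_snd (ρ / 3) hρ3
  have e6 : ∀ᶠ δ in nhdsWithin 0 (Set.Ioi 0), δ ∈ Set.Ioo 0 ρ := Ioo_mem_nhdsGT hρ
  filter_upwards [e1, e2, e3, e4, e5, e6] with δ ⟨Q, hQ₁, hQ₂, hQ⟩ h2 h3 h4 h5 h6
  have hδ0 : 0 < δ := h6.1
  have hδ : |δ| < ρ := by rw [abs_of_pos hδ0]; exact h6.2
  -- the jittered endpoints, read on brick-wall sites, are `ρ`-close to the marked points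
  have ha' : dist (meshPoint δ (![2 * (a' δ).1 0 + (a' δ).1 1 + (((a' δ).2 : ℕ) : ℤ) + 1,
      (a' δ).1 1] : Site 2)) (E.pt 0) ≤ ρ := by
    have h := dist_meshPoint_site_le hB δ (a' δ)
    have := dist_triangle (meshPoint δ (![2 * (a' δ).1 0 + (a' δ).1 1 + (((a' δ).2 : ℕ) : ℤ) + 1,
      (a' δ).1 1] : Site 2)) ((δ : ℂ) * B (hexCenter (a' δ))) (E.pt 0)
    linarith
  have hb' : dist (meshPoint δ (![2 * (b' δ).1 0 + (b' δ).1 1 + (((b' δ).2 : ℕ) : ℤ) + 1,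
      (b' δ).1 1] : Site 2)) (E.pt 1) ≤ ρ := by
    have h := dist_meshPoint_site_le hB δ (b' δ)
    have := dist_triangle (meshPoint δ (![2 * (b' δ).1 0 + (b' δ).1 1 + (((b' δ).2 : ℕ) : ℤ) + 1,
      (b' δ).1 1] : Site 2)) ((δ : ℂ) * B (hexCenter (b' δ))) (E.pt 1)
    linarith
  -- on the good event the curves are `≤ 3ρ` apart
  have hgood : ∀ pp : SAW.DomainSAW E.carrier δ (a δ) (b δ) ×
      SAW.EmbDomainSAW hexGraph (fun v : HexVertex => B (hexCenter v)) E.carrier δ (a' δ) (b' δ),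
      (∃ (α₁ β₁ α₂ β₂ m : List (Site 2)),
        pp.1.walk.support = α₁ ++ m ++ β₁ ∧
        pp.2.walk.support.map (fun w : HexVertex =>
          (![2 * w.1 0 + w.1 1 + ((w.2 : ℕ) : ℤ) + 1, w.1 1] : Site 2)) = α₂ ++ m ++ β₂ ∧
        (∀ x ∈ α₁ ++ α₂, dist (meshPoint δ x) (E.pt 0) < ρ) ∧
        (∀ x ∈ β₁ ++ β₂, dist (meshPoint δ x) (E.pt 1) < ρ)) →
      dist pp.1.curve pp.2.curve ≤ 3 * ρ := by
    rintro pp ⟨α₁, β₁, α₂, β₂, m, h₁, h₂, hα, hβ⟩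
    have h := dist_curve_le_of_support_eq hB hρ.le (E.pt 0) (E.pt 1) pp.1 pp.2 h₁ h₂
      (fun x hx => (hα x hx).le) (fun x hx => (hβ x hx).le) h2.le h3.le ha' hb'
    linarith
  -- push the coupling to `CurveClass ℂ × CurveClass ℂ`
  have hX : Measurable fun pp : SAW.DomainSAW E.carrier δ (a δ) (b δ) ×
      SAW.EmbDomainSAW hexGraph (fun v : HexVertex => B (hexCenter v)) E.carrier δ (a' δ) (b' δ) =>
      pp.1.curve :=
    (SAW.DomainSAW.measurable_of_top fun γ => γ.curve).comp measurable_fst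
  have hY : Measurable fun pp : SAW.DomainSAW E.carrier δ (a δ) (b δ) ×
      SAW.EmbDomainSAW hexGraph (fun v : HexVertex => B (hexCenter v)) E.carrier δ (a' δ) (b' δ) =>
      pp.2.curve :=
    (SAW.EmbDomainSAW.measurable_of_top fun γ => γ.curve).comp measurable_snd
  have hQX : Q.map (fun pp => pp.1.curve) =
      (SAW.brickWallLaw E.carrier δ 0 (a δ) (b δ)).map (fun γ => γ.curve) := by
    rw [← hQ₁, Measure.map_map (SAW.DomainSAW.measurable_of_top _) measurable_fst]
    rfl
  have hQY : Q.map (fun pp => pp.2.curve) =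
      (SAW.embLaw hexGraph (fun v : HexVertex => B (hexCenter v)) E.carrier δ
        SAW.hexCriticalFugacity (a' δ) (b' δ)).map (fun γ => γ.curve) := by
    rw [← hQ₂, Measure.map_map (SAW.EmbDomainSAW.measurable_of_top _) measurable_snd]
    rfl
  have hbad : Q {pp | ENNReal.ofReal (3 * ρ) < edist pp.1.curve pp.2.curve} ≤
      ENNReal.ofReal (3 * ρ) := by
    refine (measure_mono fun pp hpp => ?_).trans (hQ.trans (ENNReal.ofReal_le_ofReal (by linarith)))
    intro hg
    have h := hgood pp hg
    rw [Set.mem_setOf_eq, edist_dist] at hpp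
    exact absurd (ENNReal.ofReal_le_ofReal h) (not_le.2 hpp)
  have hLP := levyProkhorovEDist_le_of_coupling Q hX.aemeasurable hY.aemeasurable hQX hQY hbad
  rw [Real.dist_eq, sub_zero, abs_of_nonneg]
  · calc levyProkhorovDist _ _ ≤ 3 * ρ := ENNReal.toReal_le_of_le_ofReal (by positivity) hLP
      _ < ε := by rw [hρdef]; linarith
  · exact ENNReal.toReal_nonneg

/-! ### The registered helper sub-goal -/

/-- **Middle coupling implies stub L (registered helper sub-goal, literal signature).**
HYPOTHESIS (`MiddleCoupling`, the residual LATTICE estimate behind stub L; no curve topology):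
for `B = diag(2, 2/√3)`, every Dobrushin `E`, every `ℤ²` endpoint approximation `(a, b)` along
which the straight brick-wall law at `t = 0` is eventually a probability measure, every jittered
endpoint approximation `(a', b')` and every `ρ > 0`, for all small `δ > 0` there is a coupling
`Q` of the straight law `SAW.brickWallLaw E δ 0 (a δ) (b δ)` and the jittered law
`SAW.embLaw hexGraph (B ∘ hexCenter) E δ x_c (a' δ) (b' δ)` (marginal equations) under which,
off an event of `Q`-mass `≤ ρ`, the straight support and the brick-wall sites
`(2w₀ + w₁ + k + 1, w₁)` under the jittered support decompose as `α₁ ++ m ++ β₁`,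
`α₂ ++ m ++ β₂` with a COMMON middle block `m`, all prefix sites drawn (mesh `δ`) in the open
`ρ`-ball at `E.pt 0` and all suffix sites in the open `ρ`-ball at `E.pt 1` (heuristic content:
(M2a) the critical honeycomb two-point walk misses the disputed `o(1)`-collar of `∂E` away
from its endpoints; (M2b) its law away from the endpoints forgets the microscopic endpoint
data — kin `SAWCircleScreening.EndpointCoupling`, stmt-CriticalPhenomena-5465; OPEN, a
hypothesis here).  CONCLUSION: the text of stub L (`stub_jitteredLipMerging`): middle coupling ⇒
two-convention endpoint coupling (`tendsto_levyProkhorovDist_of_middleCoupling`) ⇒ L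
(`stub_jitteredLipMerging_of_endpointCoupling`, landed). [folklore] -/
theorem stub_jitteredLipMerging_of_middleCoupling : (∀ B : ℂ ≃ₜ ℂ, (∀ z : ℂ, B z = ((2 * z.re : ℝ) : ℂ) + ((2 / Real.sqrt 3 * z.im : ℝ) : ℂ) * Complex.I) → ∀ (E : DobrushinDomain) (a b : ℝ → Site 2) (a' b' : ℝ → HexVertex), SAW.IsEndpointApprox E a b → (∀ᶠ δ in nhdsWithin 0 (Set.Ioi 0), IsProbabilityMeasure (SAW.brickWallLaw E.carrier δ 0 (a δ) (b δ))) → SAW.IsEmbEndpointApprox hexGraph (fun v : HexVertex => B (hexCenter v)) E a' b' → ∀ ρ : ℝ, 0 < ρ → ∀ᶠ δ in nhdsWithin 0 (Set.Ioi 0), ∃ Q : Measure (SAW.DomainSAW E.carrier δ (a δ) (b δ) × SAW.EmbDomainSAW hexGraph (fun v : HexVertex => B (hexCenter v)) E.carrier δ (a' δ) (b' δ)), Q.map Prod.fst = SAW.brickWallLaw E.carrier δ 0 (a δ) (b δ) ∧ Q.map Prod.snd = SAW.embLaw hexGraph (fun v : HexVertex => B (hexCenter v)) E.carrier δ SAW.hexCriticalFugacity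 (a' δ) (b' δ) ∧ Q {p | ¬ ∃ α₁ β₁ α₂ β₂ m : List (Site 2), p.1.walk.support = α₁ ++ m ++ β₁ ∧ p.2.walk.support.map (fun w : HexVertex => (![2 * w.1 0 + w.1 1 + ((w.2 : ℕ) : ℤ) + 1, w.1 1] : Site 2)) = α₂ ++ m ++ β₂ ∧ (∀ x ∈ α₁ ++ α₂, dist (meshPoint δ x) (E.pt 0) < ρ) ∧ (∀ x ∈ β₁ ++ β₂, dist (meshPoint δ x) (E.pt 1) < ρ)} ≤ ENNReal.ofReal ρ) → ∀ B : ℂ ≃ₜ ℂ, (∀ z : ℂ, B z = ((2 * z.re : ℝ) : ℂ) + ((2 / Real.sqrt 3 * z.im : ℝ) : ℂ) * Complex.I) → ∀ (E : DobrushinDomain) (a b : ℝ → Site 2), SAW.IsEndpointApprox E a b → (∀ᶠ δ in nhdsWithin 0 (Set.Ioi 0), IsProbabilityMeasure (SAW.brickWallLaw E.carrier δ 0 (a δ) (b δ))) → ∃ a' b' : ℝ → HexVertex, SAW.IsEmbEndpointApprox hexGraph (fun v : HexVertex => B (hexCenter v)) E a' b' ∧ ∀ (g : BoundedContinuousFunction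 (CurveClass ℂ) ℝ) (L : NNReal), LipschitzWith L g → Tendsto (fun δ => (∫ γ, g γ.curve ∂(SAW.brickWallLaw E.carrier δ 0 (a δ) (b δ))) - ∫ γ, g γ.curve ∂(SAW.embLaw hexGraph (fun v : HexVertex => B (hexCenter v)) E.carrier δ SAW.hexCriticalFugacity (a' δ) (b' δ))) (nhdsWithin 0 (Set.Ioi 0)) (nhds 0) := by
  intro hM
  refine stub_jitteredLipMerging_of_endpointCoupling ?_
  intro B hB E a b a' b' hab hprob hab'
  exact tendsto_levyProkhorovDist_of_middleCoupling hB E a b a' b' hab hab'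
    (hM B hB E a b a' b' hab hprob hab')

end Summit.CriticalPhenomena.SAWScalingLimit.Cruxes.ModulusUniversality.Birth

end
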